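import Summits.CriticalPhenomena.PercolationContinuityZ3.Theorems.PercNearOneGluingNoHeavyLowerTailSahiCombTriWCorToolkit
import Summits.CriticalPhenomena.PercolationContinuityZ3.Theorems.PercNearOneGluingNoHeavyLowerTailSahiCombHarrisEq

/-!
# The 'PERFECT MINUS A GENERATOR' stratum of `TRI_W(a)`: `P = S \ {z}` for a perfect up-set `S`, a minimal `z ∈ S`, and a 2-element member straddling `z`

Support file of the one-cut programme (crux `NoHeavyLowerTail`, stmt-CriticalPhenomena-4575; TRI lane of cell `prim-masterthm`; seat prim-lf-1 gen 40,
memo `FROM-prim-lf-1-gen40-CYLINDER-AND-JSWITCH.md` §3; conjectured with census n ≤ 5 by prim-lf-1 gen 39, memo `…-gen39-SATURATED-STRATUM.md` §7).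
Continuation of `…SahiCombTriWSaturated` (saturated stratum), `…SahiCombTriWCorNonneg` (P5 gen 24: `corP`, `lForm = #(P∩A∩B) − corP`) and
`…SahiCombHarrisEq` (this generation: a common essential coordinate makes Kleitman's gap positive).

Let `S` be a PERFECT up-set of the cube `W = Finset γ` (self-dual: `uᶜ ∈ S ↔ u ∉ S`, i.e. a maximal intersecting family; `TriWIneq(S)` is the saturated
stratum), `z ∈ S` a MINIMAL element, and suppose `S` contains a two-element set `w = {i, j}` with `i ∈ z`, `j ∉ z`.  Then `P := S \ {z}` — an up-set
that is NOT saturated (the antipodal pair `{z, zᶜ}` is undecided) — satisfies `TriWIneq` for every index cube (**`FiveUpSet.triW_nonneg_perfectMinus`**),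
by the diagonal sandwich certificate (`c = 1`)

  `κ(e,e) = 1 (e ∈ P, e ≠ w),  κ(w,w) = 0,  κ(W,W) = 2`   — i.e. `κ(A×B) = #(P∩A∩B) − [w ∈ A∩B] + [W ∈ A∩B]` (`FiveUpSet.kapPM`, `ptVal_kapPM`):

* UPPER (`ptVal_kapPM_le_uForm`): `U_P − κ = [#(P∩C) − #(refl P∩C)] + [w∈C] − [W∈C]`, `C = A∩B`; the Kleitman gap of `(C, P)` is `≥ 1` as soon as
  `C ∉ {∅, everything}`, because EVERY coordinate is essential for `P` (`essential_perfectMinus`: outside `z` witnessed by `z ∉ P ∌… z ∪ {k} ∈ P`, inside `z`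
  by `zᶜ ∉ P`, `zᶜ ∪ {k} ∈ P`) and a non-trivial `C` has an essential coordinate (`card_inter_refl_lt_of_essential`);
* LOWER (`lForm_le_ptVal_kapPM`): `κ − L_P = Kl(A,B) − δ_A(z)δ_B(z) − [w∈A∩B] + [W∈A∩B]` with `Kl(A,B) = #(A∩B) − #(A∩refl B) = corP S` (self-duality,
  `two_mul_corP_of_selfDual`) and `corP P = corP S − δ_A(z)δ_B(z)`; the only dangerous rows have `Kl = 0`, `w ∈ A∩B` and `z, zᶜ` polarised in both
  families — there `inessential_or_of_kleitman_eq` makes coordinate `i` (resp. `j`) inessential for `A` or `B`, so `{j} ∈ A` (resp. `{i} ∈ A`), forcing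
  `zᶜ ∈ A` (resp. `z ∈ A`), a contradiction.
Coverage: at `n = 4` the orbit of `x₀x₁ ∨ x₀x₂ ∨ x₁x₂x₃` (12 up-sets, outside the saturated / relatively-saturated strata); at `n = 5` the classes of
`perfect S minus z` having a 2-set `{i,j} ∈ S` with `i ∈ z ∌ j` (gen-39 census: certificate valid for all 640 shape-ok triples `(S,z,w)`).
HONEST LABEL: complete proofs, std axioms; a new unconditional stratum of `TriWIneq` (all `n`, all `a`); `TriWIneq` itself stays OPEN. [this work]
-/

namespace Summit.CriticalPhenomena.PercolationContinuityZ3.Theorems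

namespace FiveUpSet

open Finset

variable {β γ : Type} [DecidableEq β] [Fintype β] [DecidableEq γ] [Fintype γ]

/-! ### The certificate -/

/-- The diagonal weight of the stratum: `1` on `P \ {w}` and one extra unit on the top point `univ` (so `w ↦ 0`, `univ ↦ 2`, other points of `P ↦ 1`);
written as the sum of two constant certificates `κ₁(P \ {w}) + κ₁({univ})` of `…TriWCorNonneg`. [this work] -/
def kapPM (P : Finset (Finset γ)) (w : Finset γ) (u e : Finset γ) : ℕ := kapOne (P.erase w) u e + kapOne {univ} u e

omit [DecidableEq β] [Fintype β] in
/-- `κ(A × B) = #(P∩A∩B) + [univ ∈ A∩B] − [w ∈ A∩B]` (for `w ∈ P`). [this work] -/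
theorem ptVal_kapPM {P : Finset (Finset γ)} {w : Finset γ} (hw : w ∈ P) (A B : Finset (Finset γ)) :
    ptVal (kapPM P w) A B = ((P ∩ A ∩ B).card : ℤ) + (if univ ∈ A ∩ B then 1 else 0) - (if w ∈ A ∩ B then 1 else 0) := by
  have h0 : ptVal (kapPM P w) A B = ptVal (kapOne (P.erase w)) A B + ptVal (kapOne {univ}) A B := by
    rw [← ptVal_add]; rfl
  rw [h0, ptVal_kapOne, ptVal_kapOne]
  have h1 : (((P.erase w) ∩ A ∩ B).card : ℤ) = (P ∩ A ∩ B).card - (if w ∈ A ∩ B then 1 else 0) := by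
    rw [inter_assoc, inter_assoc, erase_inter]
    by_cases hwc : w ∈ A ∩ B
    · rw [if_pos hwc]
      have hmem : w ∈ P ∩ (A ∩ B) := mem_inter.2 ⟨hw, hwc⟩
      have := card_erase_add_one hmem
      omega
    · rw [if_neg hwc, erase_eq_of_notMem (fun h => hwc (mem_inter.1 h).2)]
      ring
  have h2 : ((({univ} : Finset (Finset γ)) ∩ A ∩ B).card : ℤ) = (if univ ∈ A ∩ B then 1 else 0) := by
    rw [inter_assoc]
    by_cases hu : univ ∈ A ∩ B
    · rw [if_pos hu, singleton_inter_of_mem hu, card_singleton]; rfl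
    · rw [if_neg hu, singleton_inter_of_notMem hu, card_empty]; rfl
  rw [h1, h2]
  ring

/-! ### The objects: a perfect `S`, a minimal `z`, the straddling pair `{i,j}` -/

omit [DecidableEq β] [Fintype β] [Fintype γ] in
/-- Removing a minimal element from an up-set leaves an up-set. [this work] -/
theorem isUpperSet_erase_of_minimal {S : Finset (Finset γ)} (hS : IsUpperSet (S : Set (Finset γ))) {z : Finset γ}
    (hzmin : ∀ t ∈ S, t ⊆ z → t = z) : IsUpperSet ((S.erase z : Finset (Finset γ)) : Set (Finset γ)) := by
  intro t t' htt ht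
  rw [mem_coe, mem_erase] at ht ⊢
  refine ⟨fun h => ?_, hS htt ht.2⟩
  subst h
  exact ht.1 (hzmin t ht.2 htt)

omit [DecidableEq β] [Fintype β] in
/-- **Every coordinate is essential for `P = S \ {z}`**: for `k ∉ z` the pair `(z, z ∪ {k})`, for `k ∈ z` the pair `(zᶜ, zᶜ ∪ {k})` witnesses it. [this work] -/
theorem essential_perfectMinus {S : Finset (Finset γ)} (hS : IsUpperSet (S : Set (Finset γ))) (hsd : ∀ u : Finset γ, uᶜ ∈ S ↔ u ∉ S)
    {z : Finset γ} (hz : z ∈ S) (hzmin : ∀ t ∈ S, t ⊆ z → t = z) {j : γ} (hj : j ∉ z) (k : γ) :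
    ∃ s : Finset γ, k ∉ s ∧ insert k s ∈ S.erase z ∧ s ∉ S.erase z := by
  by_cases hk : k ∈ z
  · refine ⟨zᶜ, fun h => (mem_compl.1 h) hk, ?_, ?_⟩
    · rw [mem_erase]
      constructor
      · intro h
        have : j ∈ insert k zᶜ := mem_insert_of_mem (mem_compl.2 hj)
        rw [h] at this
        exact hj this
      · have e : insert k zᶜ = (z.erase k)ᶜ := by
          ext x
          rw [mem_insert, mem_compl, mem_compl, mem_erase, not_and_or, not_not]
        rw [e, hsd]
        intro h
        have := hzmin _ h (erase_subset k z)
        exact (notMem_erase k z) (this.symm ▸ hk)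
    · rw [mem_erase, not_and_or]
      right
      rw [hsd, not_not]
      exact hz
  · refine ⟨z, hk, ?_, fun h => (mem_erase.1 h).1 rfl⟩
    rw [mem_erase]
    refine ⟨fun h => hk (h ▸ mem_insert_self k z), hS (subset_insert k z) hz⟩

omit [DecidableEq β] [Fintype β] [Fintype γ] in
/-- A family for which every coordinate is inessential is trivial: membership does not depend on the set. [this work] -/
theorem mem_iff_empty_mem_of_forall_inessential {C : Finset (Finset γ)} (h : ∀ k : γ, Inessential k C) (u : Finset γ) :
    u ∈ C ↔ (∅ : Finset γ) ∈ C := by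
  induction u using Finset.induction_on with
  | empty => exact Iff.rfl
  | insert k u hk ih => exact (h k u hk).trans ih

omit [DecidableEq β] [Fintype β] in
/-- **Strict Kleitman against a family all of whose coordinates are essential.**  If every coordinate is essential for the up-set `P`, then for every
up-set `C` other than `∅` and the full power set, `#(C ∩ refl P) < #(C ∩ P)`.  (Reusable: the (hi) side of every J-switch certificate on an intersecting
`P` is of this form, memo §3.) [this work] -/
theorem card_inter_refl_lt_of_forall_essential {P C : Finset (Finset γ)} (hP : IsUpperSet (P : Set (Finset γ)))
    (hC : IsUpperSet (C : Set (Finset γ))) (hess : ∀ k : γ, ∃ s : Finset γ, k ∉ s ∧ insert k s ∈ P ∧ s ∉ P)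
    {u v : Finset γ} (hu : u ∈ C) (hv : v ∉ C) : (C ∩ refl P).card < (C ∩ P).card := by
  have hne : ¬ ∀ k : γ, Inessential k C := by
    intro hall
    exact hv ((mem_iff_empty_mem_of_forall_inessential hall v).2 ((mem_iff_empty_mem_of_forall_inessential hall u).1 hu))
  push Not at hne
  obtain ⟨k, hk⟩ := hne
  unfold Inessential at hk
  push Not at hk
  obtain ⟨s, hks, hs⟩ := hk
  have hsC : insert k s ∈ C ∧ s ∉ C := by
    rcases hs with h | h
    · exact h
    · exact absurd (hC (subset_insert k s) h.2) h.1
  obtain ⟨t, hkt, htP, htP'⟩ := hess k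
  exact card_inter_refl_lt_of_essential hC hP hks hsC.1 hsC.2 hkt htP htP'

omit [DecidableEq β] [Fintype β] in
/-- The UPPER sandwich inequality for `κ`. [this work] -/
theorem ptVal_kapPM_le_uForm {S : Finset (Finset γ)} (hS : IsUpperSet (S : Set (Finset γ))) (hsd : ∀ u : Finset γ, uᶜ ∈ S ↔ u ∉ S)
    {z : Finset γ} (hz : z ∈ S) (hzmin : ∀ t ∈ S, t ⊆ z → t = z) {w : Finset γ} (hw : w ∈ S.erase z) {j : γ} (hj : j ∉ z)
    {A B : Finset (Finset γ)} (hA : IsUpperSet (A : Set (Finset γ))) (hB : IsUpperSet (B : Set (Finset γ))) :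
    ptVal (kapPM (S.erase z) w) A B ≤ uForm (S.erase z) A B := by
  set P := S.erase z with hPdef
  have hP : IsUpperSet (P : Set (Finset γ)) := isUpperSet_erase_of_minimal hS hzmin
  rw [ptVal_kapPM hw]
  unfold uForm
  have hC : IsUpperSet ((A ∩ B : Finset (Finset γ)) : Set (Finset γ)) := by rw [coe_inter]; exact hA.inter hB
  -- Kleitman for the up-sets `A ∩ B` and `P`
  have hk := card_inter_refl_le hC hP
  have hk' : ((refl P ∩ A ∩ B).card : ℤ) ≤ ((P ∩ A ∩ B).card : ℤ) := by
    rw [show refl P ∩ A ∩ B = A ∩ B ∩ refl P from by ext x; simp only [mem_inter]; tauto,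
      show P ∩ A ∩ B = A ∩ B ∩ P from by ext x; simp only [mem_inter]; tauto]
    exact_mod_cast hk
  by_cases huniv : univ ∈ A ∩ B
  · by_cases hwC : w ∈ A ∩ B
    · rw [if_pos huniv, if_pos hwC]; linarith
    · rw [if_pos huniv, if_neg hwC]
      -- strict Kleitman: `A ∩ B` is neither empty nor everything, and every coordinate is essential for `P`
      have hlt := card_inter_refl_lt_of_forall_essential hP hC (essential_perfectMinus hS hsd hz hzmin hj) huniv hwC
      have hlt' : ((refl P ∩ A ∩ B).card : ℤ) < ((P ∩ A ∩ B).card : ℤ) := by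
        rw [show refl P ∩ A ∩ B = A ∩ B ∩ refl P from by ext x; simp only [mem_inter]; tauto,
          show P ∩ A ∩ B = A ∩ B ∩ P from by ext x; simp only [mem_inter]; tauto]
        exact_mod_cast hlt
      linarith
  · have hwC : w ∉ A ∩ B := fun h => huniv (hC (subset_univ w) h)
    rw [if_neg huniv, if_neg hwC]; linarith

omit [DecidableEq β] [Fintype β] in
/-- The LOWER sandwich inequality for `κ`. [this work] -/
theorem lForm_le_ptVal_kapPM {S : Finset (Finset γ)} (hsd : ∀ u : Finset γ, uᶜ ∈ S ↔ u ∉ S)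
    {z : Finset γ} (hz : z ∈ S) {i j : γ} (hi : i ∈ z) (hj : j ∉ z) (hw : ({i, j} : Finset γ) ∈ S)
    {A B : Finset (Finset γ)} (hA : IsUpperSet (A : Set (Finset γ))) (hB : IsUpperSet (B : Set (Finset γ))) :
    lForm (S.erase z) A B ≤ ptVal (kapPM (S.erase z) {i, j}) A B := by
  have hij : i ≠ j := fun h => hj (h ▸ hi)
  have hwz : ({i, j} : Finset γ) ≠ z := fun h => hj (h ▸ (mem_insert_of_mem (mem_singleton_self j)))
  have hwP : ({i, j} : Finset γ) ∈ S.erase z := mem_erase.2 ⟨hwz, hw⟩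
  rw [ptVal_kapPM hwP, lForm_eq_card_sub_corP, corP_erase hz, corP_selfDual_eq hsd]
  -- Kleitman's gap
  have hk := card_inter_refl_le hA hB
  have hk' : ((A ∩ refl B).card : ℤ) ≤ ((A ∩ B).card : ℤ) := by exact_mod_cast hk
  -- the sign product at `z` is at most 1
  have hsA : sgnDiff A (refl A) z ≤ 1 ∧ -1 ≤ sgnDiff A (refl A) z := by
    unfold sgnDiff; by_cases h1 : z ∈ A <;> by_cases h2 : z ∈ refl A <;> simp [h1, h2]
  have hsB : sgnDiff B (refl B) z ≤ 1 ∧ -1 ≤ sgnDiff B (refl B) z := by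
    unfold sgnDiff; by_cases h1 : z ∈ B <;> by_cases h2 : z ∈ refl B <;> simp [h1, h2]
  have hprod : sgnDiff A (refl A) z * sgnDiff B (refl B) z ≤ 1 := by nlinarith [hsA.1, hsA.2, hsB.1, hsB.2]
  by_cases hwC : ({i, j} : Finset γ) ∈ A ∩ B
  · have huniv : univ ∈ A ∩ B := by
      have hC : IsUpperSet ((A ∩ B : Finset (Finset γ)) : Set (Finset γ)) := by rw [coe_inter]; exact hA.inter hB
      exact hC (subset_univ _) hwC
    rw [if_pos huniv, if_pos hwC]
    -- dangerous rows: sign product `= 1` and Kleitman gap `= 0`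
    by_contra hcon
    have hgap0 : (A ∩ refl B).card = (A ∩ B).card := by
      have : ((A ∩ B).card : ℤ) - (A ∩ refl B).card < 1 := by
        by_contra h'; push Not at h'; exact hcon (by linarith)
      have h2 : ((A ∩ refl B).card : ℤ) = (A ∩ B).card := by linarith
      exact_mod_cast h2
    have hprod1 : sgnDiff A (refl A) z * sgnDiff B (refl B) z = 1 := by
      by_contra h'
      have : sgnDiff A (refl A) z * sgnDiff B (refl B) z ≤ 0 := by
        rcases lt_or_ge (sgnDiff A (refl A) z * sgnDiff B (refl B) z) 1 with h'' | h''
        · linarith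
        · exact absurd (le_antisymm hprod h'') h'
      exact hcon (by linarith)
    have hIn := inessential_or_of_kleitman_eq hA hB hgap0
    obtain ⟨hwA, hwB⟩ := mem_inter.1 hwC
    -- polarisation: both families contain `z` and not `zᶜ`, or both contain `zᶜ` and not `z`
    have hcases : (z ∈ A ∧ zᶜ ∉ A ∧ z ∈ B ∧ zᶜ ∉ B) ∨ (z ∉ A ∧ zᶜ ∈ A ∧ z ∉ B ∧ zᶜ ∈ B) := by
      unfold sgnDiff at hprod1
      simp only [mem_refl] at hprod1
      by_cases a1 : z ∈ A <;> by_cases a2 : zᶜ ∈ A <;> by_cases b1 : z ∈ B <;> by_cases b2 : zᶜ ∈ B <;>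
        simp [a1, a2, b1, b2] at hprod1 ⊢
    rcases hcases with ⟨hzA, hzcA, hzB, hzcB⟩ | ⟨hzA, hzcA, hzB, hzcB⟩
    · -- coordinate `i` is inessential for `A` or `B`; then `{j} ∈ A` (resp. `B`), hence `zᶜ ∈ A`
      have hjz : ({j} : Finset γ) ⊆ zᶜ := singleton_subset_iff.2 (mem_compl.2 hj)
      have hnij : i ∉ ({j} : Finset γ) := fun h => hij (mem_singleton.1 h)
      rcases hIn i with h | h
      · exact hzcA (hA hjz ((h {j} hnij).1 hwA))
      · exact hzcB (hB hjz ((h {j} hnij).1 hwB))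
    · -- coordinate `j` is inessential for `A` or `B`; then `{i} ∈ A` (resp. `B`), hence `z ∈ A`
      have hiz : ({i} : Finset γ) ⊆ z := singleton_subset_iff.2 hi
      have hnji : j ∉ ({i} : Finset γ) := fun h => hij (mem_singleton.1 h).symm
      have hperm : ({i, j} : Finset γ) = insert j {i} := Finset.pair_comm i j
      rw [hperm] at hwA hwB
      rcases hIn j with h | h
      · exact hzA (hA hiz ((h {i} hnji).1 hwA))
      · exact hzB (hB hiz ((h {i} hnji).1 hwB))
  · rw [if_neg hwC]
    by_cases huniv : univ ∈ A ∩ B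
    · rw [if_pos huniv]; linarith
    · rw [if_neg huniv]
      -- `A ∩ B = ∅`: one family is empty, so the sign product vanishes
      have hempty : A = ∅ ∨ B = ∅ := by
        by_contra h; push Not at h
        obtain ⟨hAne, hBne⟩ := h
        obtain ⟨a, ha⟩ := hAne
        obtain ⟨b, hb⟩ := hBne
        exact huniv (mem_inter.2 ⟨hA (subset_univ a) ha, hB (subset_univ b) hb⟩)
      have hprod0 : sgnDiff A (refl A) z * sgnDiff B (refl B) z = 0 := by
        rcases hempty with rfl | rfl
        · unfold sgnDiff; simp [refl]
        · unfold sgnDiff; simp [refl]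
      rw [hprod0]; linarith

/-- **The certificate of the stratum.** [this work] -/
theorem sandwichPt_perfectMinus {S : Finset (Finset γ)} (hS : IsUpperSet (S : Set (Finset γ))) (hsd : ∀ u : Finset γ, uᶜ ∈ S ↔ u ∉ S)
    {z : Finset γ} (hz : z ∈ S) (hzmin : ∀ t ∈ S, t ⊆ z → t = z) {i j : γ} (hi : i ∈ z) (hj : j ∉ z) (hw : ({i, j} : Finset γ) ∈ S) :
    SandwichPt (S.erase z) 1 (kapPM (S.erase z) {i, j}) := by
  have hwz : ({i, j} : Finset γ) ≠ z := fun h => hj (h ▸ (mem_insert_of_mem (mem_singleton_self j)))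
  have hwP : ({i, j} : Finset γ) ∈ S.erase z := mem_erase.2 ⟨hwz, hw⟩
  intro A B hA hB
  rw [Nat.cast_one, one_mul, one_mul]
  exact ⟨lForm_le_ptVal_kapPM hsd hz hi hj hw hA hB, ptVal_kapPM_le_uForm hS hsd hz hzmin hwP hj hA hB⟩

/-- **`TriWIneq` ON THE 'PERFECT MINUS A GENERATOR' STRATUM.**  `S` a perfect (self-dual) up-set of `Finset γ`, `z ∈ S` minimal, `{i,j} ∈ S` with `i ∈ z`,
`j ∉ z`: then `0 ≤ triW (S.erase z) F G` for EVERY index cube `Finset β` and all monotone families `F, G` of up-sets (all `n`, all `a`). [this work] -/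
theorem triW_nonneg_perfectMinus {S : Finset (Finset γ)} (hS : IsUpperSet (S : Set (Finset γ))) (hsd : ∀ u : Finset γ, uᶜ ∈ S ↔ u ∉ S)
    {z : Finset γ} (hz : z ∈ S) (hzmin : ∀ t ∈ S, t ⊆ z → t = z) {i j : γ} (hi : i ∈ z) (hj : j ∉ z) (hw : ({i, j} : Finset γ) ∈ S)
    (F G : Finset β → Finset (Finset γ))
    (hF : ∀ x, IsUpperSet (F x : Set (Finset γ))) (hG : ∀ x, IsUpperSet (G x : Set (Finset γ)))
    (hFm : Monotone F) (hGm : Monotone G) :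
    0 ≤ triW (S.erase z) F G :=
  triW_nonneg_of_sandwichPt Nat.one_pos (sandwichPt_perfectMinus hS hsd hz hzmin hi hj hw) F G hF hG hFm hGm

end FiveUpSet

end Summit.CriticalPhenomena.PercolationContinuityZ3.Theorems
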